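import Mathlib.Data.Nat.Log
import Literature.Computability.Complexity.Classes
import Literature.Computability.Complexity.Nondeterministic
import Literature.Computability.Complexity.PairProjections
import Literature.Computability.MetaComplexity.UniversalMachine
import Literature.Computability.MetaComplexity.DistProblems
import HarnessLib

/-!
# Complexity meta: time-bounded computational depth and universal heuristic schemes (Hirahara 2021)

Topic `Literature/Computability/MetaComplexity`. The vocabulary and the two top-level lemmas of
S. Hirahara, *Average-case hardness of NP from exponential worst-case hardness assumptions*
(STOC 2021; full version ECCC TR21-058, whose numbering we cite) behind its main theorem,
Thm. 1.6 (1): `UP ⊄ DTIME(2^{O(n / log n)}) ⟹ DistNP ⊄ AvgP` (the named fact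
`Literature.Computability.Cryptography.hirahara_UP_DistNP` of `Cryptography/AverageCase.lean`).
The paper (p. 12) observes that Thm. 1.6 "immediately follows from Lemmas 2.2 and 2.3"; this file
vendors exactly that layer:

* `UniversalMachine.cdAt` — the `(s,t)`-time-bounded computational depth
  `cd^{s,t}(x) = K^s(x) - K^t(x)` (Def. 6.1, oracle-free, finite budgets), over the library's
  `K^t` (`UniversalMachine.ktAt`, `ℕ∞`-valued);
* `UniversalMachine.IsUniversalHeuristicScheme`, `UniversalMachine.HasUniversalHeuristicScheme` —
  Def. 6.2: a pair `(S, C)` (solver, checker) of polynomial-time algorithms and a polynomial `p`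
  such that for all `n`, all `t ≥ p(n)`, all `x ∈ {0,1}ⁿ` and all `k`:
  (1) `cd^{t,p(t)}(x) ≤ k → C(x, 1ᵗ, 1ᵏ) = 1`, (2) `C(x, 1ᵗ, 1ᵏ) = 1 → S(x, 1ᵗ, 1^{2^k}) = L(x)`;
* the named facts (D-0014) `Hirahara2021_hasUHS_of_mem_UP` (Lemma 2.2 (1): `DistNP ⊆ AvgP` ⟹ every
  `L ∈ UP` admits a universal heuristic scheme) and `Hirahara2021_mem_DTIME_of_hasUHS` (Lemma 2.3 =
  Cor. 6.4: a universal heuristic scheme for `L` gives `L ∈ DTIME(2^{O(n / log n)})`);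
* real API: `cdAt_le_iff` (the depth condition without subtraction), `cdAt_eq_zero_of_le`,
  `cdAt_mono_right`, `IsUniversalHeuristicScheme.hasUniversalHeuristicScheme`, and the
  non-vacuity theorem `hasUniversalHeuristicScheme_of_mem_P` (every `L ∈ P` has the trivial scheme
  "checker accepts, solver decides", for every `U`).

The assembly `Lemma 2.2 (1) + Cor. 6.4 ⟹ Thm. 1.6 (1)` is proved in
`Cryptography/AverageCaseProofs.lean`.

## Design choices

* As everywhere in this topic (`UniversalMachine.lean`, `GapMINKT.lean`) the efficient universal
  machine is a hypothesis structure and every `K^t` statement quantifies `∀ U : UniversalMachine`;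
  the paper fixes one efficient `U` (Def. 2.1) and its proofs use only the properties bundled in
  `UniversalMachine` (monotone clock, polynomial-time interpreter, universality with polynomial
  overhead — absorbed by the polynomials `p`, `p(t)` of Def. 6.2 — and cheap printing programs).
* `cd^{s,t}(x)` is `ℕ∞`-valued truncated subtraction (Mathlib `WithTop.sub`: `⊤ - ↑b = ⊤`,
  `a - ⊤ = 0`). This junk value is immaterial: by `OrderedSub ℕ∞` the defining condition
  `cd^{t,p(t)}(x) ≤ k` of Def. 6.2 is *literally equivalent* to the subtraction-free
  `K^t(x) ≤ k + K^{p(t)}(x)` (`cdAt_le_iff`), and in the regime of Def. 6.2 (`t ≥ p(n)`, `p`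
  large) all values are finite (`UniversalMachine.print`/`sim`).
* Algorithms `S(x; 1ᵗ, 1ᵐ)`, `C(x; 1ᵗ, 1ᵏ)` are curried maps `List Bool → ℕ → ℕ → Bool` run on the
  library's scheme encoding `schemeEnc (x, t, m) = ⟨x, ⟨1ᵗ, 1ᵐ⟩⟩` (`DistProblems.lean`), output
  `encodeBool`; "polynomial-time" is `PolyTimeComputable schemeEnc encodeBool`, i.e. polynomial in
  `|⟨x, 1ᵗ, 1ᵐ⟩| = 2|x| + 2t + m + 4` — for the solver, whose third argument is `1^{2^k}`, this is
  `poly(|x|, t, 2^k)` exactly as printed. The decision version of Def. 6.2 is vendored (the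
  search version, Def. 8.8, is not needed for Thm. 1.6).
* `DTIME(2^{O(n / log n)})` is rendered `⋃ c, DTIME (fun n => 2 ^ (c * n / Nat.log 2 n))`,
  verbatim as in `hirahara_UP_DistNP` (see the discussion of `n ≤ 1` there).
* Not vendored here: Thm. 6.3 (the `s(n)`-parametrised form of Cor. 6.4), Cor. 6.5–6.6, items
  (2)–(3) of Lemma 2.2, `Avg_P P`; the deeper layers behind Lemma 2.2 (1) (§3.3, §4, §5, §8) are
  recorded in the tenure notes of `hirahara_UP_DistNP`.

Mathlib has no Kolmogorov complexity, computational depth or heuristic schemes (searched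
`Kolmogorov`, `depth`, `heuristic`); the tree has `K^t` (`UniversalMachine.ktAt`), `DistNP`, `AvgP`,
`UP`, `DTIME`, `schemeEnc`, all reused.

## References

* S. Hirahara, *Average-case hardness of NP from exponential worst-case hardness assumptions*,
  STOC 2021, 292–302, doi:10.1145/3406325.3451065; full version ECCC TR21-058 (2021): Def. 2.1,
  Lemma 2.2, Lemma 2.3, Def. 6.1, Def. 6.2, Thm. 6.3, Cor. 6.4, §11.
* L. Antunes, L. Fortnow, D. van Melkebeek, N. V. Vinodchandran, *Computational depth: concept and
  applications*, Theoret. Comput. Sci. 354 (2006) — computational depth `K^t(x) - K(x)`.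
-/

namespace Literature.Computability.MetaComplexity

open _root_.Computability Complexity Complexity.Classes Complexity.Nondeterministic

namespace UniversalMachine

variable (U : UniversalMachine)

/-! ### Time-bounded computational depth (Def. 6.1) -/

/-- The `(s,t)`-**time-bounded computational depth** of `x` (oracle-free, finite budgets):
`cd^{s,t}(x) := K^s(x) - K^t(x)`, as an element of `ℕ∞` (truncated subtraction of the library's
`ℕ∞`-valued `K^t = U.ktAt`; `⊤ - ↑b = ⊤`, `a - ⊤ = 0`, immaterial by `cdAt_le_iff`). Used with
`s ≤ t`, where it is the number of description bits saved by the extra time.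
[Hirahara 2021 (ECCC TR21-058), Def. 6.1; Antunes–Fortnow–van Melkebeek–Vinodchandran 2006]
[cite: Hirahara2021, Def. 6.1] -/
noncomputable def cdAt (s t : ℕ) (x : List Bool) : ℕ∞ :=
  U.ktAt s x - U.ktAt t x

/-- The depth condition without subtraction: `cd^{s,t}(x) ≤ k ↔ K^s(x) ≤ k + K^t(x)` (exact in
`ℕ∞`, Mathlib `tsub_le_iff_right` for the `OrderedSub` instance of `WithTop ℕ`).
[Hirahara 2021 (ECCC TR21-058), Def. 6.1] [cite: Hirahara2021, Def. 6.1] -/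
theorem cdAt_le_iff {s t : ℕ} {x : List Bool} {k : ℕ∞} :
    U.cdAt s t x ≤ k ↔ U.ktAt s x ≤ k + U.ktAt t x :=
  tsub_le_iff_right

/-- With *less* time in the second slot the depth vanishes: `t ≤ s → cd^{s,t}(x) = 0`
(`K^s ≤ K^t` by `ktAt_anti`). [Hirahara 2021 (ECCC TR21-058), Def. 6.1] [cite: Hirahara2021, Def. 6.1] -/
theorem cdAt_eq_zero_of_le {s t : ℕ} (h : t ≤ s) (x : List Bool) : U.cdAt s t x = 0 :=
  tsub_eq_zero_of_le (U.ktAt_anti h x)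

/-- The depth is monotone in the second budget: more time can only save more bits.
[Hirahara 2021 (ECCC TR21-058), Def. 6.1] [cite: Hirahara2021, Def. 6.1] -/
theorem cdAt_mono_right (s : ℕ) {t t' : ℕ} (h : t ≤ t') (x : List Bool) :
    U.cdAt s t x ≤ U.cdAt s t' x :=
  tsub_le_tsub_left (U.ktAt_anti h x) _

/-! ### Universal heuristic schemes (Def. 6.2) -/

/-- `U.IsUniversalHeuristicScheme L S C`: the pair `(S, C)` of a **solver** `S(x; 1ᵗ, 1ᵐ)` and a
**checker** `C(x; 1ᵗ, 1ᵏ)` is a *universal heuristic scheme* for the language `L` (w.r.t. the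
universal machine `U`): both are polynomial-time algorithms on the scheme encoding
`⟨x, ⟨1ᵗ, 1ᵐ⟩⟩ = schemeEnc (x, t, m)` with Boolean output, and for some polynomial `p`, for every
`x` (of length `n`), every `t ≥ p(n)` and every `k`:
(1) if `cd^{t,p(t)}(x) ≤ k` then `C(x; 1ᵗ, 1ᵏ) = 1`, and
(2) if `C(x; 1ᵗ, 1ᵏ) = 1` then `S(x; 1ᵗ, 1^{2^k}) = L(x)`.
The solver receives `2^k` in unary, so "polynomial time" for it means `poly(|x|, t, 2^k)`.
(Decision version; the paper's Def. 8.8 search version is not vendored.)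
[Hirahara 2021 (ECCC TR21-058), Def. 6.2] [cite: Hirahara2021, Def. 6.2] -/
structure IsUniversalHeuristicScheme (L : Language Bool) (S C : List Bool → ℕ → ℕ → Bool) :
    Prop where
  /-- The solver runs in time polynomial in `|⟨x, ⟨1ᵗ, 1ᵐ⟩⟩|`. -/
  solver_polyTime :
    PolyTimeComputable schemeEnc encodeBool fun q : List Bool × ℕ × ℕ => S q.1 q.2.1 q.2.2
  /-- The checker runs in time polynomial in `|⟨x, ⟨1ᵗ, 1ᵏ⟩⟩|`. -/
  checker_polyTime :
    PolyTimeComputable schemeEnc encodeBool fun q : List Bool × ℕ × ℕ => C q.1 q.2.1 q.2.2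
  /-- Items (1) and (2) of Def. 6.2 for some polynomial `p`, all `x`, all `t ≥ p(|x|)`, all `k`. -/
  exists_polynomial : ∃ p : Polynomial ℕ, ∀ (x : List Bool) (t k : ℕ), p.eval x.length ≤ t →
    (U.cdAt t (p.eval t) x ≤ k → C x t k = true) ∧
    (C x t k = true → S x t (2 ^ k) = L.boolIndicator x)

/-- `U.HasUniversalHeuristicScheme L`: the language `L` *admits a universal heuristic scheme*
(some solver/checker pair satisfies Def. 6.2). [Hirahara 2021 (ECCC TR21-058), Def. 6.2 and
Lemma 2.2] [cite: Hirahara2021, Def. 6.2] -/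
def HasUniversalHeuristicScheme (L : Language Bool) : Prop :=
  ∃ S C : List Bool → ℕ → ℕ → Bool, U.IsUniversalHeuristicScheme L S C

variable {U}

/-- A universal heuristic scheme witnesses `HasUniversalHeuristicScheme`.
[Hirahara 2021 (ECCC TR21-058), Def. 6.2] [cite: Hirahara2021, Def. 6.2] -/
theorem IsUniversalHeuristicScheme.hasUniversalHeuristicScheme {L : Language Bool}
    {S C : List Bool → ℕ → ℕ → Bool} (h : U.IsUniversalHeuristicScheme L S C) :
    U.HasUniversalHeuristicScheme L :=
  ⟨S, C, h⟩

end UniversalMachine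

/-! ### Non-vacuity: the trivial scheme for `L ∈ P` -/

/-- The constant checker `⟨x, ⟨1ᵗ, 1ᵏ⟩⟩ ↦ 1` is polynomial-time (a zero-emission finite-state
transduction with front word `[true]`, `FST.polyTimeComputable_eval`). [folklore] -/
theorem polyTimeComputable_schemeEnc_const_true :
    PolyTimeComputable schemeEnc encodeBool fun _ : List Bool × ℕ × ℕ => true := by
  let T : FST Unit Bool Bool := ⟨(), fun _ _ => ((), []), fun _ => [true], fun _ => true⟩
  have hrun : ∀ (s : Unit) (l : List Bool), T.run s l = ((), []) := by
    intro s l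
    induction l generalizing s with
    | nil => rfl
    | cons b l ih => rw [FST.run_cons, ih]; rfl
  have heval : ∀ l : List Bool, T.eval l = [true] := fun l => by
    rw [FST.eval, hrun]
    rfl
  obtain ⟨p, M, hM⟩ := T.polyTimeComputable_eval
  refine ⟨p, M, fun q => ?_⟩
  have h := hM (schemeEnc q)
  rw [heval] at h
  exact h

/-- For `L ∈ P`, the parameter-ignoring solver `⟨x, ⟨1ᵗ, 1ᵐ⟩⟩ ↦ L(x)` is polynomial-time: decide
`L` (`mem_P_iff_holds`) after the first pair projection (`boolUnpairFst_mem_FP`), composed by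
`PolyTimeComputable.comp_holds`. [Arora–Barak 2009, §1.3 (composition); Bogdanov–Trevisan 2006,
§2.1 (worst-case easy problems are average-case easy)] [folklore] -/
theorem polyTimeComputable_schemeEnc_boolIndicator {L : Language Bool} (hL : L ∈ P) :
    PolyTimeComputable schemeEnc encodeBool fun q : List Bool × ℕ × ℕ => L.boolIndicator q.1 := by
  have hdec : PolyTimeComputable id encodeBool L.boolIndicator :=
    polyTimeDecidable_iff.1 (mem_P_iff_holds.1 hL)
  have hfst : PolyTimeComputable (id : List Bool → List Bool) id fun z => (boolUnpair z).1 :=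
    boolUnpairFst_mem_FP
  obtain ⟨p, M, hM⟩ := PolyTimeComputable.comp_holds hdec hfst
  refine ⟨p, M, fun q => ?_⟩
  have hq : (boolUnpair (schemeEnc q)).1 = q.1 := by simp [schemeEnc]
  have h := hM (schemeEnc q)
  simp only [id, Function.comp, hq] at h
  exact h

/-- **Non-vacuity of Def. 6.2.** Every `L ∈ P` admits a universal heuristic scheme with respect to
every universal machine: the checker always accepts and the solver decides `L` ignoring its
parameters (any polynomial `p` works; item (1) is vacuous-free since `C ≡ 1`, item (2) holds by
correctness of the decider). This is the worst-case end of the paper's remark that universal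
heuristic schemes interpolate between worst-case and average-case polynomial time.
[Hirahara 2021 (ECCC TR21-058), Def. 6.2 and §2.1] [cite: Hirahara2021, Def. 6.2] -/
theorem hasUniversalHeuristicScheme_of_mem_P (U : UniversalMachine) {L : Language Bool}
    (hL : L ∈ P) : U.HasUniversalHeuristicScheme L :=
  ⟨fun x _ _ => L.boolIndicator x, fun _ _ _ => true,
    { solver_polyTime := polyTimeComputable_schemeEnc_boolIndicator hL
      checker_polyTime := polyTimeComputable_schemeEnc_const_true
      exists_polynomial := ⟨0, fun _ _ _ _ => ⟨fun _ => rfl, fun _ => rfl⟩⟩ }⟩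

/-! ### Hirahara's Lemma 2.2 (1) and Lemma 2.3 / Cor. 6.4 (named facts) -/

/-- **Hirahara 2021, Lemma 2.2 (1).** *If `DistNP ⊆ AvgP`, then every language in `UP` admits a
universal heuristic scheme.* (Proved in the paper via §11: `DistNP ⊆ AvgP` gives
`coNP × {U, T} ⊆ Avg¹_{1-n^{-c}} P`; `UP ⊆ NP_sv` (Fact 8.4); Cor. 8.12 builds the scheme for
`NP_sv` from algorithmic language compression (Thm. 4.2), weak symmetry of information (Thm. 5.2),
`Gap MINKT ∈ P` (Lemma 5.1) and the `k`-wise direct product generator (Thm. 3.12).)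
Conventions: `∀ U : UniversalMachine` (see the module docstring), `DistNP`, `AvgP` of
`DistProblems.lean` (Bogdanov–Trevisan, as in the paper's §3.1), `UP` of `Nondeterministic.lean`.
[Hirahara 2021 (ECCC TR21-058), Lemma 2.2 (1); proof §11 via Fact 8.4 and Cor. 8.12]
[cite: Hirahara2021, Lemma 2.2 (1)] -/
def Hirahara2021_hasUHS_of_mem_UP : Prop :=
  ∀ U : UniversalMachine, DistNP ⊆ AvgP →
    ∀ L ∈ UP, U.HasUniversalHeuristicScheme L

/-- **Hirahara 2021, Lemma 2.3 (= Corollary 6.4).** *If there exists a universal heuristic scheme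
`(S, C)` for a language `L`, then `L ∈ DTIME(2^{O(n / log n)})`.* (Proof, Thm. 6.3 with
`s(n) = n + O(1)`: iterate `p`, `p₀(n) = n`, `p_{i+1} = p ∘ p_i`; by the telescoping sum
`Σ_{i ≤ I} cd^{p_i(n), p_{i+1}(n)}(x) ≤ K^{p(n)}(x) ≤ n + O(1)` some `i ≤ I := ε log n` has depth
`≤ k := (n + O(1))/I`, so the checker accepts `(x, 1^{p_i(n)}, 1ᵏ)` and the solver answers
`L(x)` in time `poly(p_I(n), 2^k) = 2^{O(n / log n)}`.)
`DTIME(2^{O(n / log n)})` is `⋃ c, DTIME (fun n => 2 ^ (c * n / Nat.log 2 n))` as in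
`Literature.Computability.Cryptography.hirahara_UP_DistNP`.
[Hirahara 2021 (ECCC TR21-058), Lemma 2.3 and Cor. 6.4 (via Thm. 6.3)]
[cite: Hirahara2021, Cor. 6.4] -/
def Hirahara2021_mem_DTIME_of_hasUHS : Prop :=
  ∀ (U : UniversalMachine) (L : Language Bool), U.HasUniversalHeuristicScheme L →
    L ∈ ⋃ c : ℕ, DTIME (fun n => 2 ^ (c * n / Nat.log 2 n))

end Literature.Computability.MetaComplexity
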